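import Summits.NavierStokesRegularity.FunctionalMining.StretchingLaminateStepAlgebra
import HarnessLib

/-!
# K1-Q1 laminate step, part 5: matrix ALGEBRA — crude bounds, linearity, the ceiling core, the expansions

Cell `pub-nsfunc` (host summit NavierStokesRegularity, topic `FunctionalMining`), prove seat gen 6, for the
`LaminateStep` node (dict BLUEPRINT §2–§3; algebra of `StretchingLaminateStepAlgebra`). **Search for candidate a
priori estimates; no regularity claim.** Pure algebra on real `3 × 3` matrices; no fields, no integrals.

* crude entrywise bounds: `abs_triBC_le` (`54abc`), `abs_prodBC_le'` (`54β³`), `abs_mix₂_le` (`162yx²`),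
  `abs_frob_le` (`9yx`), `abs_halfSqM_le` (`(9/2)x²`), `abs_halfSqM_sub_le` (perturbation `9ρ(β+ρ)`);
  linearity `mix₂_sub_left`, `frob_sub_left`;
* **`ceiling_core`**: the pointwise vorticity ceiling of the laminate step as a statement about eight matrices
  and a handful of reals (convexity on plateaus and ramps + the perturbation bound `24ρ′(β′+ρ′)`);
* **`prodBC_expand_core`, `halfSqM_expand_core`**: on the support of an envelope the laminate slope sits at a
  plateau value, so the densities expand in powers of the envelope with CONSTANT base matrices.
-/

noncomputable section

namespace Summit.NavierStokesRegularity.FunctionalMining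

namespace Laminate

open WrapStretching Confinement

/-! ## 1. Crude entrywise bounds and linearity -/

/-- `|triBC A B C| ≤ 54·a·b·c` under entrywise bounds. [ours; elementary] -/
theorem abs_triBC_le {A B C : Fin 3 → Fin 3 → ℝ} {a b c : ℝ} (hA : ∀ i j, |A i j| ≤ a) (hB : ∀ i j, |B i j| ≤ b)
    (hC : ∀ i j, |C i j| ≤ c) : |triBC A B C| ≤ 54 * a * b * c := by
  have ha : 0 ≤ a := (abs_nonneg _).trans (hA 0 0)
  have hb : 0 ≤ b := (abs_nonneg _).trans (hB 0 0)
  have hc : 0 ≤ c := (abs_nonneg _).trans (hC 0 0)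
  have h1 : |∑ i, ∑ j, ∑ k, A i j * B j k * C k i| ≤ 27 * (a * b * c) :=
    abs_sum3_le fun i j k => by
      rw [abs_mul, abs_mul]
      exact mul_le_mul (mul_le_mul (hA i j) (hB j k) (abs_nonneg _) ha) (hC k i) (abs_nonneg _) (mul_nonneg ha hb)
  have h2 : |∑ m, ∑ i, ∑ j, A i m * (B j m * C j i)| ≤ 27 * (a * (b * c)) :=
    abs_sum3_le fun m i j => by
      rw [abs_mul, abs_mul]
      exact mul_le_mul (hA i m) (mul_le_mul (hB j m) (hC j i) (abs_nonneg _) hb)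
        (mul_nonneg (abs_nonneg _) (abs_nonneg _)) ha
  have e : triBC A B C = (∑ i, ∑ j, ∑ k, A i j * B j k * C k i) - ∑ m, ∑ i, ∑ j, A i m * (B j m * C j i) := by
    simp only [triBC, Finset.mul_sum]
  rw [e]
  calc _ ≤ |∑ i, ∑ j, ∑ k, A i j * B j k * C k i| + |∑ m, ∑ i, ∑ j, A i m * (B j m * C j i)| := abs_sub _ _
    _ ≤ 27 * (a * b * c) + 27 * (a * (b * c)) := add_le_add h1 h2
    _ = 54 * a * b * c := by ring

/-- `|prodBC X| ≤ 54β³`. [ours; elementary] -/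
theorem abs_prodBC_le' {X : Fin 3 → Fin 3 → ℝ} {β : ℝ} (hX : ∀ i j, |X i j| ≤ β) : |prodBC X| ≤ 54 * β ^ 3 := by
  rw [prodBC_eq_triBC]
  calc _ ≤ 54 * β * β * β := abs_triBC_le hX hX hX
    _ = 54 * β ^ 3 := by ring

/-- `|mix₂ Y X| ≤ 162·y·x²`. [ours; elementary] -/
theorem abs_mix₂_le {Y X : Fin 3 → Fin 3 → ℝ} {y x : ℝ} (hY : ∀ i j, |Y i j| ≤ y) (hX : ∀ i j, |X i j| ≤ x) :
    |mix₂ Y X| ≤ 162 * y * x ^ 2 := by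
  unfold mix₂
  have h1 := abs_triBC_le hY hX hX
  have h2 := abs_triBC_le hX hY hX
  have h3 := abs_triBC_le hX hX hY
  calc _ ≤ |triBC Y X X| + |triBC X Y X| + |triBC X X Y| := abs_add_three _ _ _
    _ ≤ 54 * y * x * x + 54 * x * y * x + 54 * x * x * y := by linarith
    _ = 162 * y * x ^ 2 := by ring

/-- `|mix₁ Y X| ≤ 162·y²·x`. [ours; elementary] -/
theorem abs_mix₁_le {Y X : Fin 3 → Fin 3 → ℝ} {y x : ℝ} (hY : ∀ i j, |Y i j| ≤ y) (hX : ∀ i j, |X i j| ≤ x) :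
    |mix₁ Y X| ≤ 162 * y ^ 2 * x := by
  unfold mix₁
  have h1 := abs_triBC_le hY hY hX
  have h2 := abs_triBC_le hY hX hY
  have h3 := abs_triBC_le hX hY hY
  calc _ ≤ |triBC Y Y X| + |triBC Y X Y| + |triBC X Y Y| := abs_add_three _ _ _
    _ ≤ 54 * y * y * x + 54 * y * x * y + 54 * x * y * y := by linarith
    _ = 162 * y ^ 2 * x := by ring

/-- `|frob Y X| ≤ 9·y·x`. [ours; elementary] -/
theorem abs_frob_le {Y X : Fin 3 → Fin 3 → ℝ} {y x : ℝ} (hY : ∀ i j, |Y i j| ≤ y) (hX : ∀ i j, |X i j| ≤ x) :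
    |frob Y X| ≤ 9 * y * x := by
  have hy : 0 ≤ y := (abs_nonneg _).trans (hY 0 0)
  unfold frob
  calc _ ≤ ∑ i, |∑ j, Y i j * X i j| := Finset.abs_sum_le_sum_abs _ _
    _ ≤ ∑ i, ∑ j, |Y i j * X i j| := Finset.sum_le_sum fun i _ => Finset.abs_sum_le_sum_abs _ _
    _ ≤ ∑ _i : Fin 3, ∑ _j : Fin 3, y * x := Finset.sum_le_sum fun i _ => Finset.sum_le_sum fun j _ => by
        rw [abs_mul]; exact mul_le_mul (hY i j) (hX i j) (abs_nonneg _) hy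
    _ = 9 * y * x := by simp; ring

/-- `|halfSqM X| ≤ (9/2)·x²`. [ours; elementary] -/
theorem abs_halfSqM_le {X : Fin 3 → Fin 3 → ℝ} {x : ℝ} (hX : ∀ i j, |X i j| ≤ x) : |halfSqM X| ≤ 9 / 2 * x ^ 2 := by
  rw [abs_of_nonneg (halfSqM_nonneg X)]
  unfold halfSqM
  have h : ∀ i j, X i j ^ 2 ≤ x ^ 2 := fun i j => by
    have := hX i j
    rw [← sq_abs]; exact pow_le_pow_left₀ (abs_nonneg _) this 2
  have hs : ∑ i, ∑ j, X i j ^ 2 ≤ ∑ _i : Fin 3, ∑ _j : Fin 3, x ^ 2 :=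
    Finset.sum_le_sum fun i _ => Finset.sum_le_sum fun j _ => h i j
  simp at hs
  linarith

/-- `mix₂` is linear in the base: `mix₂ A X − mix₂ B X = mix₂ (A − B) X`. [ours; elementary] -/
theorem mix₂_sub_left (A B X : Fin 3 → Fin 3 → ℝ) : mix₂ A X - mix₂ B X = mix₂ (A - B) X := by
  simp only [mix₂, triBC, Fin.sum_univ_three, Pi.sub_apply]
  ring

/-- `frob` is linear in the base: `frob A X − frob B X = frob (A − B) X`. [ours; elementary] -/
theorem frob_sub_left (A B X : Fin 3 → Fin 3 → ℝ) : frob A X - frob B X = frob (A - B) X := by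
  simp only [frob, Fin.sum_univ_three, Pi.sub_apply]
  ring

/-- **The enstrophy density under perturbation**: `|halfSqM Y − halfSqM X| ≤ 9ρ(β+ρ)` when `|X| ≤ β`,
`|Y − X| ≤ ρ` entrywise. [ours; elementary] -/
theorem abs_halfSqM_sub_le {X Y : Fin 3 → Fin 3 → ℝ} {β ρ : ℝ} (hX : ∀ i j, |X i j| ≤ β)
    (hY : ∀ i j, |Y i j - X i j| ≤ ρ) : |halfSqM Y - halfSqM X| ≤ 9 * ρ * (β + ρ) := by
  have hρ : 0 ≤ ρ := (abs_nonneg _).trans (hY 0 0)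
  have e : Y = X + (Y - X) := by abel
  have hR : ∀ i j, |(Y - X) i j| ≤ ρ := fun i j => hY i j
  rw [e, halfSqM_add, show halfSqM X + frob X (Y - X) + halfSqM (Y - X) - halfSqM X =
    frob X (Y - X) + halfSqM (Y - X) by ring]
  calc _ ≤ |frob X (Y - X)| + |halfSqM (Y - X)| := abs_add_le _ _
    _ ≤ 9 * β * ρ + 9 / 2 * ρ ^ 2 := add_le_add (abs_frob_le hX hR) (abs_halfSqM_le hR)
    _ ≤ 9 * ρ * (β + ρ) := by nlinarith

/-- Entry bound for `G + t•M` with `|t| ≤ 1`. [ours; bookkeeping] -/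
theorem abs_add_smul_entry_le {G M : Fin 3 → Fin 3 → ℝ} {t βG βM : ℝ} (hG : ∀ i j, |G i j| ≤ βG)
    (hM : ∀ i j, |M i j| ≤ βM) (ht : |t| ≤ 1) (i j : Fin 3) : |(G + t • M) i j| ≤ βG + βM := by
  have hβM : 0 ≤ βM := (abs_nonneg _).trans (hM 0 0)
  simp only [Pi.add_apply, Pi.smul_apply, smul_eq_mul]
  calc _ ≤ |G i j| + |t * M i j| := abs_add_le _ _
    _ ≤ βG + 1 * βM := add_le_add (hG i j) (by rw [abs_mul]; exact mul_le_mul ht (hM i j) (abs_nonneg _) zero_le_one)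
    _ = βG + βM := by ring

/-! ## 2. The ceiling core -/

/-- From `|vortᵢ(T)² − vortᵢ(Z)²| ≤ 8ρ(β+ρ)` (tree `abs_vort_sq_sub_le` with `e = 1`) to
`|ω(T)|² ≤ |ω(Z)|² + 24ρ(β+ρ)`. [ours; elementary] -/
theorem vortSqM_le_of_close {Z T : Fin 3 → Fin 3 → ℝ} {β ρ : ℝ} (hZ : ∀ i j, |Z i j| ≤ β)
    (hT : ∀ i j, |T i j - Z i j| ≤ ρ) : vortSqM T ≤ vortSqM Z + 24 * ρ * (β + ρ) := by
  have h1 : |(1 : ℝ)| ≤ 1 := by rw [abs_one]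
  have hT' : ∀ i j, |T i j - 1 * Z i j| ≤ ρ := fun i j => by rw [one_mul]; exact hT i j
  have h := fun i => abs_vort_sq_sub_le h1 hZ hT' i
  rw [vortSqM_eq_sum_vort_sq, vortSqM_eq_sum_vort_sq, Fin.sum_univ_three, Fin.sum_univ_three]
  have h0 := (abs_le.1 (h 0)).2
  have h1' := (abs_le.1 (h 1)).2
  have h2 := (abs_le.1 (h 2)).2
  simp only [one_pow, one_mul] at h0 h1' h2
  linarith

/-- **CEILING CORE.** The laminate-step gradient `T = G + sM + g₊ + g₋` at one point: `s ∈ [−μ, 1−μ]` the laminate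
slope, `θ± ∈ [0,1]` the envelope values with the plateau nesting (`θ₊ ≠ 0 ⇒ s = 1−μ, θ₋ = 0`;
`θ₋ ≠ 0 ⇒ s = −μ, θ₊ = 0`), children `g±` within `ρ±` of `θ±·X±`, ceilings `B±` for the child states on segments.
Then `|ω(T)|² ≤ max B₊ B₋ + 24ρ′(β′+ρ′)`, `ρ′ = 2εβ_M + ρ₊ + ρ₋`, `β′ = β_G + β_M + β_X`. [ours] -/
theorem ceiling_core {G M Xp Xm gP gM T : Fin 3 → Fin 3 → ℝ}
    {lam mu s θp θm Bp Bm βG βM βX ρp ρm ε : ℝ}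
    (hGp : vortSqM (G + (1 - lam) • M) ≤ Bp) (hGm : vortSqM (G + (-lam) • M) ≤ Bm)
    (hVp : vortSqM (G + (1 - lam) • M + Xp) ≤ Bp) (hVm : vortSqM (G + (-lam) • M + Xm) ≤ Bm)
    (hθp : 0 ≤ θp ∧ θp ≤ 1) (hθm : 0 ≤ θm ∧ θm ≤ 1) (hs : -mu ≤ s ∧ s ≤ 1 - mu)
    (hlam : 0 < lam ∧ lam < 1) (hmu : |mu - lam| ≤ 2 * ε)
    (hA : θp ≠ 0 → s = 1 - mu ∧ θm = 0) (hB : θm ≠ 0 → s = -mu ∧ θp = 0)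
    (hβG : ∀ i j, |G i j| ≤ βG) (hβM : ∀ i j, |M i j| ≤ βM)
    (hβXp : ∀ i j, |Xp i j| ≤ βX) (hβXm : ∀ i j, |Xm i j| ≤ βX)
    (hgP : ∀ i j, |gP i j - θp * Xp i j| ≤ ρp) (hgM : ∀ i j, |gM i j - θm * Xm i j| ≤ ρm)
    (hT : ∀ i j, T i j = G i j + s * M i j + gP i j + gM i j) :
    vortSqM T ≤ max Bp Bm + 24 * (2 * ε * βM + ρp + ρm) * ((βG + βM + βX) + (2 * ε * βM + ρp + ρm)) := by
  have hβM0 : 0 ≤ βM := (abs_nonneg _).trans (hβM 0 0)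
  have hβX0 : 0 ≤ βX := (abs_nonneg _).trans (hβXp 0 0)
  have hρp0 : 0 ≤ ρp := (abs_nonneg _).trans (hgP 0 0)
  have hρm0 : 0 ≤ ρm := (abs_nonneg _).trans (hgM 0 0)
  -- the shift `(λ − μ)M` is small
  have hshift : ∀ i j, |(lam - mu) * M i j| ≤ 2 * ε * βM := fun i j => by
    rw [abs_mul, abs_sub_comm]; exact mul_le_mul hmu (hβM i j) (abs_nonneg _) (by linarith [abs_nonneg (mu - lam)])
  -- a child that is switched off is pure remainder
  have hoffP : θp = 0 → ∀ i j, |gP i j| ≤ ρp := fun h i j => by simpa [h] using hgP i j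
  have hoffM : θm = 0 → ∀ i j, |gM i j| ≤ ρm := fun h i j => by simpa [h] using hgM i j
  -- the three cases produce a convex core `Z₀` with the right ceiling, entry bound and distance to `T`
  obtain ⟨Z₀, hZ1, hZ2, hZ3⟩ : ∃ Z₀ : Fin 3 → Fin 3 → ℝ, vortSqM Z₀ ≤ max Bp Bm ∧
      (∀ i j, |Z₀ i j| ≤ βG + βM + βX) ∧ ∀ i j, |T i j - Z₀ i j| ≤ 2 * ε * βM + ρp + ρm := by
    by_cases hp : θp = 0
    · by_cases hm : θm = 0
      · -- ramps / bare plateaus: `Z₀ = G + (s + μ − λ)M`, a convex combination of `G₋, G₊`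
        refine ⟨G + (s + mu - lam) • M, ?_, fun i j => ?_, fun i j => ?_⟩
        · have e : G + (s + mu - lam) • M = (G + (-lam) • M) + (s + mu) • ((G + (1 - lam) • M) - (G + (-lam) • M)) := by
            ext i j; simp only [Pi.add_apply, Pi.smul_apply, Pi.sub_apply, smul_eq_mul]; ring
          rw [e]
          exact (vortSqM_convexComb_le _ _ (by linarith [hs.1]) (by linarith [hs.2])).trans
            (max_le (le_max_of_le_right hGm) (le_max_of_le_left hGp))
        · have ht : |s + mu - lam| ≤ 1 := by rw [abs_le]; constructor <;> linarith [hs.1, hs.2, hlam.1, hlam.2]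
          exact (abs_add_smul_entry_le hβG hβM ht i j).trans (by linarith)
        · have e : T i j - (G + (s + mu - lam) • M) i j = (lam - mu) * M i j + gP i j + gM i j := by
            rw [hT]; simp only [Pi.add_apply, Pi.smul_apply, smul_eq_mul]; ring
          rw [e]
          calc _ ≤ |(lam - mu) * M i j| + |gP i j| + |gM i j| := abs_add_three _ _ _
            _ ≤ _ := by linarith [hshift i j, hoffP hp i j, hoffM hm i j]
      · -- on the support of `E₋`: base `G₋`, active child `X₋`
        obtain ⟨hsm, hp0⟩ := hB hm
        refine ⟨(G + (-lam) • M) + θm • Xm, ?_, fun i j => ?_, fun i j => ?_⟩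
        · exact (vortSqM_segment_le_of_le hθm.1 hθm.2 hGm hVm).trans (le_max_right _ _)
        · have ht : |(-lam)| ≤ 1 := by rw [abs_le]; constructor <;> linarith [hlam.1, hlam.2]
          simp only [Pi.add_apply, Pi.smul_apply, smul_eq_mul]
          calc _ ≤ |G i j + -lam * M i j| + |θm * Xm i j| := abs_add_le _ _
            _ ≤ (βG + βM) + 1 * βX := add_le_add (by simpa using abs_add_smul_entry_le hβG hβM ht i j)
                (by rw [abs_mul, abs_of_nonneg hθm.1]; exact mul_le_mul hθm.2 (hβXm i j) (abs_nonneg _) zero_le_one)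
            _ = βG + βM + βX := by ring
        · have e : T i j - ((G + (-lam) • M) + θm • Xm) i j = (lam - mu) * M i j + gP i j + (gM i j - θm * Xm i j) := by
            rw [hT, hsm]; simp only [Pi.add_apply, Pi.smul_apply, smul_eq_mul]; ring
          rw [e]
          calc _ ≤ |(lam - mu) * M i j| + |gP i j| + |gM i j - θm * Xm i j| := abs_add_three _ _ _
            _ ≤ _ := by linarith [hshift i j, hoffP hp0 i j, hgM i j]
    · -- on the support of `E₊`: base `G₊`, active child `X₊`
      obtain ⟨hsp, hm0⟩ := hA hp
      refine ⟨(G + (1 - lam) • M) + θp • Xp, ?_, fun i j => ?_, fun i j => ?_⟩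
      · exact (vortSqM_segment_le_of_le hθp.1 hθp.2 hGp hVp).trans (le_max_left _ _)
      · have ht : |1 - lam| ≤ 1 := by rw [abs_le]; constructor <;> linarith [hlam.1, hlam.2]
        simp only [Pi.add_apply, Pi.smul_apply, smul_eq_mul]
        calc _ ≤ |G i j + (1 - lam) * M i j| + |θp * Xp i j| := abs_add_le _ _
          _ ≤ (βG + βM) + 1 * βX := add_le_add (by simpa using abs_add_smul_entry_le hβG hβM ht i j)
              (by rw [abs_mul, abs_of_nonneg hθp.1]; exact mul_le_mul hθp.2 (hβXp i j) (abs_nonneg _) zero_le_one)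
          _ = βG + βM + βX := by ring
      · have e : T i j - ((G + (1 - lam) • M) + θp • Xp) i j = (lam - mu) * M i j + (gP i j - θp * Xp i j) + gM i j := by
          rw [hT, hsp]; simp only [Pi.add_apply, Pi.smul_apply, smul_eq_mul]; ring
        rw [e]
        calc _ ≤ |(lam - mu) * M i j| + |gP i j - θp * Xp i j| + |gM i j| := abs_add_three _ _ _
          _ ≤ _ := by linarith [hshift i j, hgP i j, hoffM hm0 i j]
  exact (vortSqM_le_of_close hZ2 hZ3).trans (by linarith)

/-! ## 3. The expansions on the plateaus -/

/-- **Production density of the laminate-step main term**: with the plateau nesting, `prodBC` of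
`G + sM + θ₊X₊ + θ₋X₋` splits into the laminate part and cubic polynomials in `θ±` with the CONSTANT bases
`Y₊ = G + (1−μ)M`, `Y₋ = G − μM`. [ours] -/
theorem prodBC_expand_core {G M Xp Xm : Fin 3 → Fin 3 → ℝ} {mu s θp θm : ℝ}
    (hA : θp ≠ 0 → s = 1 - mu ∧ θm = 0) (hB : θm ≠ 0 → s = -mu ∧ θp = 0) :
    prodBC (G + s • M + θp • Xp + θm • Xm) = prodBC (G + s • M) +
      (θp * mix₁ (G + (1 - mu) • M) Xp + θp ^ 2 * mix₂ (G + (1 - mu) • M) Xp + θp ^ 3 * prodBC Xp) +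
      (θm * mix₁ (G + (-mu) • M) Xm + θm ^ 2 * mix₂ (G + (-mu) • M) Xm + θm ^ 3 * prodBC Xm) := by
  by_cases hp : θp = 0
  · by_cases hm : θm = 0
    · simp [hp, hm]
    · obtain ⟨hs, _⟩ := hB hm
      rw [hp, hs, zero_smul, add_zero, prodBC_segment]
      ring
  · obtain ⟨hs, hm⟩ := hA hp
    rw [hm, hs, zero_smul, add_zero, prodBC_segment]
    ring

/-- **Enstrophy density of the main term**, same mechanism. [ours] -/
theorem halfSqM_expand_core {G M Xp Xm : Fin 3 → Fin 3 → ℝ} {mu s θp θm : ℝ}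
    (hA : θp ≠ 0 → s = 1 - mu ∧ θm = 0) (hB : θm ≠ 0 → s = -mu ∧ θp = 0) :
    halfSqM (G + s • M + θp • Xp + θm • Xm) = halfSqM (G + s • M) +
      (θp * frob (G + (1 - mu) • M) Xp + θp ^ 2 * halfSqM Xp) +
      (θm * frob (G + (-mu) • M) Xm + θm ^ 2 * halfSqM Xm) := by
  by_cases hp : θp = 0
  · by_cases hm : θm = 0
    · simp [hp, hm]
    · obtain ⟨hs, _⟩ := hB hm
      rw [hp, hs, zero_smul, add_zero, halfSqM_segment]
      ring
  · obtain ⟨hs, hm⟩ := hA hp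
    rw [hm, hs, zero_smul, add_zero, halfSqM_segment]
    ring

/-- The target side: `prodBC (Y + X) = prodBC Y + mix₁ Y X + mix₂ Y X + prodBC X` (re-export of `prodBC_add`
in the shape used by the statistics). [ours; bookkeeping] -/
theorem prodBC_add' (Y X : Fin 3 → Fin 3 → ℝ) :
    prodBC (Y + X) = prodBC Y + (mix₁ Y X + (mix₂ Y X + prodBC X)) := by
  rw [prodBC_add]; ring

/-- The target side for the enstrophy density. [ours; bookkeeping] -/
theorem halfSqM_add' (Y X : Fin 3 → Fin 3 → ℝ) : halfSqM (Y + X) = halfSqM Y + (frob Y X + halfSqM X) := by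
  rw [halfSqM_add]; ring

end Laminate

end Summit.NavierStokesRegularity.FunctionalMining

end
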